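import Literature.NumberTheory.PAdicHodge.UnitKummerLogCochainInvariant
import Literature.NumberTheory.PAdicHodge.LogCyclotomicZpExtensionMultiple
import Literature.NumberTheory.EllipticCurves.IwasawaCyclotomicProofs
import HarnessLib

/-!
# Kato II Lemma 1.4.5 with `ψ = log χ_cyclo` itself: `inv_∞(κ_∞(u) ∪ log χ_cyclo) = −log_p(N_{K_v/ℚ_p} u)`

Topic `Literature/NumberTheory/PAdicHodge`; THEOREMS ONLY (no definition, no named fact, no instance, no `sorry`). Sequel of
`GaloisCohomology/CupProductMuPadicCharacter` (edix-p4 g17/g18: `invPadic_cupProduct_kummerPadic_eq_neg_mul_of_isCyclotomic` — for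
`ψ = a · (κ ∘ res_v)`, `κ` the cyclotomic `ℤ_p`-extension of the number field `K`, a unit `u ∈ 𝒪_v` and ANY `σ ∈ Γ_K` with
`ε_p(σ) = N_{K_v/ℚ_p}(u)`: `inv_∞(κ_∞(u) ∪ [ψ]) = −a · κ(σ)`), of `LogCyclotomicZpExtensionMultiple` (g19: `log χ_cyclo = a · κ ∘ res_v`)
and of `UnitKummerLogCochainInvariant` (g19: the same read on `B_dR⁺`-valued cochains presented through the period line).

This file removes the two auxiliary data `(a, σ)` from the endpoint and states Kato's Lemma 1.4.5 with Kato's own character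
`log(χ_cyclo) ∈ Hom_cont(Γ_{K_v}, ℤ_p)` and with the value Kato gives, `−log(χ_cyclo(rec u)) = −log_p(N_{K_v/ℚ_p} u)`:

* §1 (any field `F`) `norm_logCyclotomic_le_one` (`log χ_cyclo(τ) ∈ ℤ_p`), ★ `exists_continuousMap_coe_eq_logCyclotomic` — THE
  `ℤ_p`-valued continuous additive lift `ψ_log` of `log χ_cyclo` (via `log χ = ℓ(χ) · log_p γ_cyc`, `logCyclotomic_eq_ell_mul`, and the
  continuous hom `CyclotomicZp.ellHom`), `continuousMap_coe_eq_logCyclotomic_unique` (any two lifts agree);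
* §2 (number field `K`, cyclotomic `κ`) ★ `exists_logCyclotomic_eq_mul_and_restrict` — ONE `a ∈ ℤ_p` with `log χ_cyclo = a · κ` on `Γ_K`
  AND `log χ_cyclo = a · κ ∘ res` on `Γ_L` for every field `L ⊇ K` (the global clause is what turns `−a · κ(σ)` into `−log_p ε_p(σ)`);
* §3 (a completion `K_v`, `v ∣ p`) ★ `exists_cyclotomicCharacter_eq_norm_of_valuation_eq_one` /
  `exists_cyclotomicCharacter_absGaloisRestrict_eq_norm` — for a unit `u ∈ 𝒪_vˣ` there IS `τ ∈ Γ_{K_v}` (resp. `σ = res_v τ ∈ Γ_K`) with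
  `ε_p = N_{K_v/ℚ_p}(u)` (`Art_v(I) = 𝒪_vˣ`, `isLocalArtinMap_canonicalArtin_holds`, and `ε_p ∘ Art_v = N` on inertia,
  `cyclotomicCharacter_toAbsGalois_eq_norm_canonicalArtin`) — the hypothesis `hσ` of the g17/g18/g19 endpoints, discharged;
* §4 ★★ `invPadic_cupProduct_kummerPadic_logCyclotomic_eq_neg_unitLog_norm` — **for EVERY continuous additive `ψ : Γ_{K_v} → ℤ_p` with
  `(ψ τ : ℚ_p) = log χ_cyclo(τ)` and every unit `u ∈ 𝒪_vˣ`: `inv_∞(κ_∞(u) ∪ [ψ]) = −log_p(N_{K_v/ℚ_p} u)` in `ℚ_p`** (`log_p = IUT.LogVolume.unitLog`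
  on `ℚ_p`, `N` for the canonical `ℚ_p`-structure `LocalField.padicAlgebra`), and ★★
  `invPadic_twoCocycleClass_eq_neg_unitLog_norm_of_logCyclotomic_presentation` — the same value for EVERY continuous `2`-cocycle of
  `ℤ_p(1)` presented through the period line `ι : ℤ_p(1) → B_dR⁺(K_v)` by the cochain `τ ↦ ψ(τ) · ℓ_u` (Kato II §1.4.4 `δ[log χ · ℓ_u]`).

What is still NOT here (honest): the last rewriting `log_p(N_{K_v/ℚ_p} u) = Tr_{K_v/ℚ_p}(log_p u)` — it is the tree's
`IUT.LogVolume.unitLog_norm_eq_trace_unitLog`, which wants a `NormedAlgebra ℚ_[p] K_v` structure compatible with `LocalField.padicAlgebra`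
(the valuation norm `IsNonarchimedeanLocalField.nontriviallyNormedField` is only a power of it); that bridge is a separate file.
Line `kato_lever` of crux K★ `stmt-BirchSwinnertonDyer-22226` ((H5) endpoint, σ-free); BSD / K★ / [REC] are NOT proved by any of this.

## References
* K. Kato, LNM 1553 (1993), Ch. II §1.2.2, §1.4.4, Lemma 1.4.5 (`inv((exp a) ∪ log χ_cyclo) = −Tr(a)`, via `−log χ_cyclo(rec)`). [Kato1993LNM1553]
* J.-P. Serre, *Local Fields* (1979), XIV §1 Prop. 3; *Local class field theory* (Cassels–Fröhlich Ch. VI) §3.1 Thm. 2, §2.4. [SerreLocalFields1979] [CasselsFrohlichANT1967]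
* L. C. Washington, *Introduction to Cyclotomic Fields* (1997), §13.1. [Washington1997]
-/

noncomputable section

open Field Function ValuativeRel WittVector NumberField IsDedekindDomain
open scoped NumberField

namespace Literature.NumberTheory.PAdicHodge

open Literature.NumberTheory.GaloisRepresentations
open Literature.NumberTheory.GaloisRepresentations.IsNonarchimedeanLocalField
open Literature.NumberTheory.GaloisCohomology
open Literature.NumberTheory.EllipticCurves
open Literature.NumberTheory.EllipticCurves.CyclotomicZp
open Literature.IUT.LogVolume

/-! ## §1 The `ℤ_p`-valued lift of `log χ_cyclo` (any field) -/

section AnyField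

variable (F : Type) [Field F] (p : ℕ) [Fact p.Prime]

/-- `log χ_cyclo(τ)` is a `p`-adic INTEGER: `‖log_p(χ_p τ)‖ ≤ 1` (`= ‖ℓ(χ_p τ)‖ · ‖log_p γ_cyc‖ ≤ 1 · p^{-e₀}`).
[cite: Kato1993LNM1553, Ch. II §1.2.2] -/
theorem norm_logCyclotomic_le_one (τ : absoluteGaloisGroup F) : ‖logCyclotomic (F := F) p τ‖ ≤ 1 := by
  rw [logCyclotomic_eq_ell_mul, norm_mul, ← PadicInt.norm_def]
  exact mul_le_one₀ (PadicInt.norm_le_one _) (norm_nonneg _)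
    ((norm_unitLog_cyclotomicGenerator_le p).trans (PadicInt.norm_le_one _))

/-- ★ **THE `ℤ_p`-valued `log χ_cyclo`**: there is a continuous additive `ψ : Γ_F → ℤ_p` with `(ψ τ : ℚ_p) = log χ_cyclo(τ)` for all `τ`
(Kato II 1.2.2: `log(χ_cyclo) ∈ H¹(F, ℤ_p) = Hom_cont(Γ_F, ℤ_p)`). Construction: `ψ = (ℓ ∘ χ_p) · log_p γ_cyc` with the continuous
homomorphism `ℓ = CyclotomicZp.ellHom` (`logCyclotomic_eq_ell_mul`). [cite: Kato1993LNM1553, Ch. II §1.2.2] -/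
theorem exists_continuousMap_coe_eq_logCyclotomic :
    ∃ ψ : C(absoluteGaloisGroup F, ℤ_[p]), (∀ σ τ, ψ (σ * τ) = ψ σ + ψ τ) ∧
      ∀ τ, (ψ τ : ℚ_[p]) = logCyclotomic (F := F) p τ := by
  have hn : ‖unitLog ((cyclotomicGenerator p : ℤ_[p]) : ℚ_[p])‖ ≤ 1 :=
    (norm_unitLog_cyclotomicGenerator_le p).trans (PadicInt.norm_le_one _)
  set c : ℤ_[p] := ⟨unitLog ((cyclotomicGenerator p : ℤ_[p]) : ℚ_[p]), hn⟩ with hc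
  refine ⟨⟨fun τ => Multiplicative.toAdd (ellHom p (GaloisRep.cyclotomicCharacter F p τ)) * c,
      (continuous_toAdd.comp ((ellHom p).continuous.comp (GaloisRep.cyclotomicCharacter F p).continuous)).mul
        continuous_const⟩, fun σ τ => ?_, fun τ => ?_⟩
  · change Multiplicative.toAdd (ellHom p (GaloisRep.cyclotomicCharacter F p (σ * τ))) * c = _ * c + _ * c
    rw [map_mul, map_mul, toAdd_mul, add_mul]
  · change (((Multiplicative.toAdd (ellHom p (GaloisRep.cyclotomicCharacter F p τ)) * c : ℤ_[p])) : ℚ_[p]) = _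
    rw [logCyclotomic_eq_ell_mul, PadicInt.coe_mul]
    rfl

/-- Any two `ℤ_p`-valued lifts of `log χ_cyclo` coincide (`ℤ_p → ℚ_p` is injective). [cite: Kato1993LNM1553, Ch. II §1.2.2] -/
theorem continuousMap_coe_eq_logCyclotomic_unique {ψ ψ' : C(absoluteGaloisGroup F, ℤ_[p])}
    (hψ : ∀ τ, (ψ τ : ℚ_[p]) = logCyclotomic (F := F) p τ) (hψ' : ∀ τ, (ψ' τ : ℚ_[p]) = logCyclotomic (F := F) p τ) :
    ψ = ψ' :=
  ContinuousMap.ext fun τ => PadicInt.ext (by rw [hψ, hψ'])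

end AnyField

/-! ## §2 `log χ_cyclo = a · κ` globally and under every restriction, ONE `a` -/

section Global

variable {K : Type} [Field K] [NumberField K] {p : ℕ} [Fact p.Prime]

/-- ★ **One `a ∈ ℤ_p` with `log χ_cyclo = a · κ` on `Γ_K` AND `log χ_cyclo = a · (κ ∘ res)` on `Γ_L` for every field `L ⊇ K`**
(`κ` the cyclotomic `ℤ_p`-extension of the number field `K`): `a = a₀ · log_p γ_cyc` where `ℓ ∘ χ_p = a₀ · κ`
(`IsCyclotomic.exists_ell_cyclotomicCharacter_eq_mul`), `log χ = ℓ(χ) · log_p γ_cyc` (`logCyclotomic_eq_ell_mul`), and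
`χ_K(res τ) = χ_L(τ)` (`cyclotomicCharacter_absGaloisRestrict`). The global clause evaluates the constant `−a · κ(σ)` of the
`ℤ_p`-packaged endpoint as `−log χ_cyclo(σ) = −log_p ε_p(σ)`. [cite: Kato1993LNM1553, Ch. II §1.2.2 and Lemma 1.4.5]
[cite: Washington1997, §13.1] -/
theorem exists_logCyclotomic_eq_mul_and_restrict {κ : ZpExtension K p} (hκ : κ.IsCyclotomic) :
    ∃ a : ℤ_[p], (∀ σ : absoluteGaloisGroup K,
        logCyclotomic (F := K) p σ = ((a * (κ σ).toAdd : ℤ_[p]) : ℚ_[p])) ∧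
      ∀ (L : Type) [Field L] [Algebra K L] (τ : absoluteGaloisGroup L),
        logCyclotomic (F := L) p τ = ((a * (κ (absGaloisRestrict K L τ)).toAdd : ℤ_[p]) : ℚ_[p]) := by
  obtain ⟨a₀, ha₀⟩ := hκ.exists_ell_cyclotomicCharacter_eq_mul
  have hn : ‖unitLog ((cyclotomicGenerator p : ℤ_[p]) : ℚ_[p])‖ ≤ 1 :=
    (norm_unitLog_cyclotomicGenerator_le p).trans (PadicInt.norm_le_one _)
  haveI : NeZero (p : K) := ⟨Nat.cast_ne_zero.2 (Fact.out : p.Prime).ne_zero⟩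
  have hK : ∀ σ : absoluteGaloisGroup K, logCyclotomic (F := K) p σ =
      ((a₀ * ⟨unitLog ((cyclotomicGenerator p : ℤ_[p]) : ℚ_[p]), hn⟩ * (κ σ).toAdd : ℤ_[p]) : ℚ_[p]) := fun σ => by
    rw [logCyclotomic_eq_ell_mul, ha₀, PadicInt.coe_mul, PadicInt.coe_mul, PadicInt.coe_mul]
    change _ = (a₀ : ℚ_[p]) * unitLog ((cyclotomicGenerator p : ℤ_[p]) : ℚ_[p]) * _
    ring
  refine ⟨a₀ * ⟨unitLog ((cyclotomicGenerator p : ℤ_[p]) : ℚ_[p]), hn⟩, hK, fun L _ _ τ => ?_⟩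
  rw [← hK (absGaloisRestrict K L τ)]
  simp only [logCyclotomic, cyclotomicCharacter_absGaloisRestrict K L p τ]

end Global

/-! ## §3 `ε_p(σ) = N_{K_v/ℚ_p}(u)` is attained, for every unit `u` -/

section Completion

variable {K : Type} [Field K] [NumberField K] {p : ℕ} [Fact p.Prime] (v : HeightOneSpectrum (𝓞 K))
  [CharZero (v.adicCompletion K)]

/-- ★ **For a unit `u ∈ 𝒪_vˣ` there is `τ ∈ Γ_{K_v}` with `ε_p(τ) = N_{K_v/ℚ_p}(u)`** in `ℚ_p` (canonical `ℚ_p`-structure of `K_v`):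
`u = Art_v(w)` for some `w` in the inertia subgroup of `W_{K_v}` (`Art_v(I) = 𝒪_vˣ`, `isLocalArtinMap_canonicalArtin_holds`) and
`ε_p(w) = N(Art_v w)` (`cyclotomicCharacter_toAbsGalois_eq_norm_canonicalArtin`, geometric normalisation).
[cite: CasselsFrohlichANT1967, Ch. VI §3.1 Thm. 2 with §2.4] [cite: SerreLocalFields1979, XIV §1 Prop. 3] -/
theorem exists_cyclotomicCharacter_eq_norm_of_valuation_eq_one
    (hpv : valuation (v.adicCompletion K) (p : v.adicCompletion K) < 1)
    (u : v.adicCompletion K) (hu : u ≠ 0) (hu1 : valuation (v.adicCompletion K) u = 1) :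
    ∃ τ : absoluteGaloisGroup (v.adicCompletion K),
      letI := LocalField.padicAlgebra (v.adicCompletion K) p hpv
      (((GaloisRep.cyclotomicCharacter (v.adicCompletion K) p τ : ℤ_[p]ˣ) : ℤ_[p]) : ℚ_[p]) = Algebra.norm ℚ_[p] u := by
  have hmem : Units.mk0 u hu ∈
      (WeilGroup.inertia (v.adicCompletion K)).map (canonicalArtin (v.adicCompletion K)) := by
    rw [(isLocalArtinMap_canonicalArtin_holds (v.adicCompletion K)).image_inertia, Valuation.mem_unitGroup_iff]
    exact hu1
  obtain ⟨w, hwI, hw⟩ := Subgroup.mem_map.mp hmem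
  refine ⟨WeilGroup.toAbsGalois (v.adicCompletion K) w, ?_⟩
  rw [cyclotomicCharacter_toAbsGalois_eq_norm_canonicalArtin p (v.adicCompletion K) hpv hwI, hw]
  rfl

/-- ★ **Global form**: for a unit `u ∈ 𝒪_vˣ` there is `σ ∈ Γ_K` (a restriction `res_v τ`) with `ε_p(σ) = N_{K_v/ℚ_p}(u)` in `ℚ_p` —
the hypothesis `hσ` of `invPadic_cupProduct_kummerPadic_eq_neg(_mul)_of_isCyclotomic` and of
`invPadic_twoCocycleClass_eq_neg_mul_of_unitKummerLog_presentation`, DISCHARGED (`χ_K ∘ res_v = χ_{K_v}`,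
`cyclotomicCharacter_absGaloisRestrict`). [cite: CasselsFrohlichANT1967, Ch. VI §3.1 Thm. 2 with §2.4] -/
theorem exists_cyclotomicCharacter_absGaloisRestrict_eq_norm
    (hpv : valuation (v.adicCompletion K) (p : v.adicCompletion K) < 1)
    (u : v.adicCompletion K) (hu : u ≠ 0) (hu1 : valuation (v.adicCompletion K) u = 1) :
    ∃ σ : absoluteGaloisGroup K,
      letI := LocalField.padicAlgebra (v.adicCompletion K) p hpv
      (((GaloisRep.cyclotomicCharacter K p σ : ℤ_[p]ˣ) : ℤ_[p]) : ℚ_[p]) = Algebra.norm ℚ_[p] u := by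
  haveI : NeZero (p : K) := ⟨Nat.cast_ne_zero.2 (Fact.out : p.Prime).ne_zero⟩
  obtain ⟨τ, hτ⟩ := exists_cyclotomicCharacter_eq_norm_of_valuation_eq_one v hpv u hu hu1
  exact ⟨absGaloisRestrict K (v.adicCompletion K) τ, by
    rw [cyclotomicCharacter_absGaloisRestrict K (v.adicCompletion K) p τ]; exact hτ⟩

/-! ## §4 The endpoint with `ψ = log χ_cyclo`: value `−log_p(N_{K_v/ℚ_p} u)` -/

variable [LocallyCompactSpace (absoluteGaloisGroup (v.adicCompletion K))]

/-- ★★ **Kato II Lemma 1.4.5 at `v ∣ p`, verbatim with `ψ = log χ_cyclo`**: for every continuous additive `ψ : Γ_{K_v} → ℤ_p` lifting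
`log χ_cyclo` (`(ψ τ : ℚ_p) = log_p(χ_p τ)`; it exists, `exists_continuousMap_coe_eq_logCyclotomic`) and every unit `u ∈ 𝒪_vˣ`,
**`inv_∞(κ_∞(u) ∪ [ψ]) = −log_p(N_{K_v/ℚ_p} u)` in `ℚ_p`** — `log_p = IUT.LogVolume.unitLog` on `ℚ_p`, `N` for the canonical
`ℚ_p`-structure `LocalField.padicAlgebra`. Chain: a cyclotomic `κ` exists (`exists_cyclotomicZpExtension_holds`); §2 gives
`ψ = a · κ ∘ res_v` and `log_p ε_p(σ) = a · κ(σ)` on `Γ_K`; §3 gives `σ` with `ε_p(σ) = N(u)`; the `ℤ_p`-packaged endpoint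
`invPadic_cupProduct_kummerPadic_eq_neg_mul_of_isCyclotomic` gives `−a · κ(σ) = −log_p ε_p(σ) = −log_p N(u)`. Instances of `K_v`
(`CharZero`, `LocallyCompactSpace Γ_{K_v}`) are binders (discharged by `LocalField.charZero_adicCompletion`,
`absoluteGaloisGroup_compactSpace`). [cite: Kato1993LNM1553, Ch. II Lemma 1.4.5 and §1.2.2] [cite: SerreLocalFields1979, XIV §1 Prop. 3] -/
theorem invPadic_cupProduct_kummerPadic_logCyclotomic_eq_neg_unitLog_norm
    (hpv : valuation (v.adicCompletion K) (p : v.adicCompletion K) < 1)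
    (ψ : C(absoluteGaloisGroup (v.adicCompletion K), ℤ_[p])) (hψ : ∀ σ τ, ψ (σ * τ) = ψ σ + ψ τ)
    (hψlog : ∀ τ, (ψ τ : ℚ_[p]) = logCyclotomic (F := v.adicCompletion K) p τ)
    (u : v.adicCompletion K) (hu : u ≠ 0) (hu1 : valuation (v.adicCompletion K) u = 1) :
    letI := LocalField.padicAlgebra (v.adicCompletion K) p hpv
    ((invPadic (v.adicCompletion K) p ((twistPairingPadic (v.adicCompletion K) p).cupProduct
        (kummerPadic (v.adicCompletion K) p u hu)
        (oneCocycleClass _ (homOneCocycle (v.adicCompletion K) p ψ hψ))) : ℤ_[p]) : ℚ_[p]) =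
      -unitLog (Algebra.norm ℚ_[p] u) := by
  letI := LocalField.padicAlgebra (v.adicCompletion K) p hpv
  obtain ⟨κ, hκ⟩ := exists_cyclotomicZpExtension_holds K p
  obtain ⟨a, haK, haL⟩ := exists_logCyclotomic_eq_mul_and_restrict hκ
  have hψκ : ∀ τ, ψ τ = a * (κ (absGaloisRestrict K (v.adicCompletion K) τ)).toAdd := fun τ =>
    PadicInt.ext (by rw [hψlog, haL])
  obtain ⟨σ, hσ⟩ := exists_cyclotomicCharacter_absGaloisRestrict_eq_norm v hpv u hu hu1
  rw [invPadic_cupProduct_kummerPadic_eq_neg_mul_of_isCyclotomic κ hκ v hpv a ψ hψ hψκ u hu hu1 σ hσ, PadicInt.coe_neg,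
    ← haK σ, ← hσ]
  rfl

variable [Fact (¬ IsUnit (p : integerC (v.adicCompletion K)))]
  [IsAdicComplete (Ideal.span {(p : integerC (v.adicCompletion K))}) (integerC (v.adicCompletion K))]

/-- ★★ **Kato II §1.4.4 + Lemma 1.4.5 on cochains, σ-free**: for every continuous additive lift `ψ : Γ_{K_v} → ℤ_p` of `log χ_cyclo`,
every unit `u ∈ 𝒪_vˣ` and EVERY continuous `2`-cocycle `c` of `ℤ_p(1)(K̄_v)` presented through the period line `ι : ℤ_p(1) → B_dR⁺(K_v)`
by the cochain `τ ↦ ψ(τ) · ℓ_u` (`ℓ_u = unitKummerLog`): **`inv_∞[c] = −log_p(N_{K_v/ℚ_p} u)` in `ℚ_p`**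
(`cupProduct_kummerPadic_eq_twoCocycleClass_of_presentation` + the previous theorem). Instances of `K_v` are binders.
[cite: Kato1993LNM1553, Ch. II §1.4.4 and Lemma 1.4.5] [cite: BlochKato1990, Ex. 3.10.1] -/
theorem invPadic_twoCocycleClass_eq_neg_unitLog_norm_of_logCyclotomic_presentation
    (hpv : valuation (v.adicCompletion K) (p : v.adicCompletion K) < 1)
    (hF : Function.Surjective (fontaineTheta (integerC (v.adicCompletion K)) p))
    (ψ : C(absoluteGaloisGroup (v.adicCompletion K), ℤ_[p])) (hψ : ∀ σ τ, ψ (σ * τ) = ψ σ + ψ τ)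
    (hψlog : ∀ τ, (ψ τ : ℚ_[p]) = logCyclotomic (F := v.adicCompletion K) p τ)
    (u : v.adicCompletion K) (hu : u ≠ 0) (hu1 : valuation (v.adicCompletion K) u = 1)
    {c : contTwoCocycles (tateModuleMuPadic (v.adicCompletion K) p).toTopRep}
    (hc : IsCoboundaryLift (ρ := tateModuleMuPadic (v.adicCompletion K) p) (BdRPlusTop.galRepr (v.adicCompletion K) p)
      (BdRPlusTop.periodLine (v.adicCompletion K) p)
      (fun τ => BdRPlusTop.of (v.adicCompletion K) p (qpToBdR ((ψ τ : ℤ_[p]) : ℚ_[p])) *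
        BdRPlusTop.unitKummerLog hpv hF hu (norm_algebraMap_normedAlgClosure_le_one_of_valuation_le_one hu1.le)) c) :
    letI := LocalField.padicAlgebra (v.adicCompletion K) p hpv
    ((invPadic (v.adicCompletion K) p (twoCocycleClass _ c) : ℤ_[p]) : ℚ_[p]) = -unitLog (Algebra.norm ℚ_[p] u) := by
  rw [← cupProduct_kummerPadic_eq_twoCocycleClass_of_presentation hpv hF hu
    (norm_algebraMap_normedAlgClosure_le_one_of_valuation_le_one hu1.le) (homOneCocycle (v.adicCompletion K) p ψ hψ) hc]
  exact invPadic_cupProduct_kummerPadic_logCyclotomic_eq_neg_unitLog_norm v hpv ψ hψ hψlog u hu hu1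

end Completion

end Literature.NumberTheory.PAdicHodge

end
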